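import Summits.QuantumFields.YangMills.Theorems.ParabolicTrajectoryContinuumLimitOnTrajectoryFlowDefs

/-!
# Stub `stub_momentsOfFreeEnergies` (line curtiss-flowed-free-energies of crux ContinuumLimitOnTrajectory) PROVED

The registered stub `stub_momentsOfFreeEnergies : Statement.stub_momentsOfFreeEnergies` — the
measure-theoretic glue between the ENGINE (convergence of the flowed free energies `flowF`, the
log-moment-generating functions of the flowed observables `X_k(τ, fᵢ)`, for small real sources:
`FFEConv`) and CURTISS (the abstract hypothesis `CurtissTheorem`): given continuity of the flowed
observables (`FlowXContinuous`), every centred mixed flowed moment converges (`FlowMomentsConv`).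

Proof. Push the torus Wilson probability measure `μ_k` forward under the continuous map
`U ↦ (X_k(τ,fᵢ)(U))ᵢ : GaugeConfig → ℝᵐ`; the configuration space is compact (and Borel, `G` being
second countable through the closed embedding `r.ρ`), so every continuous function of the `Xᵢ` is
integrable and the push-forward laws `ν_k` have all exponential moments, with
`∫ exp(∑ sᵢxᵢ) dν_k = exp(flowF_k(s))` convergent on the cube `|sᵢ| < δ`. Curtiss gives convergence of
all raw mixed moments `∫ ∏_{i∈t} Xᵢ dμ_k`; expanding `∏ᵢ (Xᵢ − ⟨Xᵢ⟩) = ∑_t (∏_{i∈t} Xᵢ) ∏_{i∉t} (−⟨Xᵢ⟩)`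
(`Finset.prod_add`) finishes by the algebra of limits.
-/

set_option autoImplicit false

open scoped SchwartzMap
open MeasureTheory Filter Topology
open Literature.MathematicalPhysics.QuantumFieldTheory Literature.MathematicalPhysics.QuantumLattice
open Literature.Probability.LatticeModels

noncomputable section

namespace Summit.QuantumFields.YangMills.Cruxes.ContinuumLimitOnTrajectory.CurtissFlowedFreeEnergies

/-- On a finite index type, `∏ᵢ xᵢ ^ 𝟙[i ∈ t] = ∏_{i ∈ t} xᵢ`. [folklore] -/
theorem prod_pow_indicator {m : ℕ} (t : Finset (Fin m)) (x : Fin m → ℝ) :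
    ∏ i, x i ^ (if i ∈ t then 1 else 0) = ∏ i ∈ t, x i := by
  simp only [pow_boole]
  exact Fintype.prod_ite_mem t x

/-- REGISTERED STUB `stub_momentsOfFreeEnergies` (glue): Curtiss' theorem (by name) and continuity of
the flowed observables turn convergence of the flowed free energies on a real cube around `0` into
convergence of every centred mixed flowed moment. [folklore] -/
theorem stub_momentsOfFreeEnergies : Statement.stub_momentsOfFreeEnergies := by
  intro hC G _ _ _ _ _ _ r sch hcont hFFE m f τ hτ
  haveI : SecondCountableTopology G :=
    (r.continuous.isClosedEmbedding r.injective).isEmbedding.secondCountableTopology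
  -- continuity of the flowed observables, integrability of continuous functions on the compact torus
  have hX : ∀ (k : ℕ) (i : Fin m), Continuous (flowX r sch τ (f i) k) := fun k i =>
    hcont τ hτ (f i) k
  have hXv : ∀ k : ℕ, Continuous fun (U : GaugeConfig 4 (sch.side k) G) (i : Fin m) =>
      flowX r sch τ (f i) k U := fun k => continuous_pi (hX k)
  have hint : ∀ (k : ℕ) {F : GaugeConfig 4 (sch.side k) G → ℝ}, Continuous F →
      Integrable F (μW r sch k) := fun k F hF =>
    hF.integrable_of_hasCompactSupport (HasCompactSupport.of_compactSpace _)
  -- the push-forward laws on `ℝᵐ`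
  set ν : ℕ → Measure (Fin m → ℝ) := fun k =>
    (μW r sch k).map fun (U : GaugeConfig 4 (sch.side k) G) (i : Fin m) => flowX r sch τ (f i) k U
  have hν : ∀ k, IsProbabilityMeasure (ν k) := fun k =>
    Measure.isProbabilityMeasure_map (hXv k).measurable.aemeasurable
  have hνint : ∀ (k : ℕ) (g : (Fin m → ℝ) → ℝ), Continuous g →
      ∫ x, g x ∂(ν k) = ∫ U, g (fun i => flowX r sch τ (f i) k U) ∂(μW r sch k) := fun k g hg =>
    integral_map (hXv k).measurable.aemeasurable hg.aestronglyMeasurable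
  have hνi : ∀ (k : ℕ) (g : (Fin m → ℝ) → ℝ), Continuous g → Integrable g (ν k) := fun k g hg =>
    (integrable_map_measure hg.aestronglyMeasurable (hXv k).measurable.aemeasurable).2
      (hint k (hg.comp (hXv k)))
  -- Curtiss' hypothesis: exponential moments exist and converge on the cube `|sᵢ| < δ`
  obtain ⟨δ, hδ, hF⟩ := hFFE m f τ hτ
  have hexp : ∀ s : Fin m → ℝ, Continuous fun x : Fin m → ℝ => Real.exp (∑ i, s i * x i) := fun s =>
    Real.continuous_exp.comp (continuous_finsetSum _ fun i _ => continuous_const.mul (continuous_apply i))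
  have hhyp : ∀ s : Fin m → ℝ, (∀ i, |s i| < δ) →
      (∀ k, Integrable (fun x => Real.exp (∑ i, s i * x i)) (ν k)) ∧
        ∃ L : ℝ, Tendsto (fun k => ∫ x, Real.exp (∑ i, s i * x i) ∂(ν k)) atTop (𝓝 L) := by
    intro s hs
    refine ⟨fun k => hνi k _ (hexp s), ?_⟩
    obtain ⟨c, hc⟩ := hF s hs
    refine ⟨Real.exp c, ?_⟩
    have hpos : ∀ k, 0 < ∫ U, Real.exp (∑ i, s i * flowX r sch τ (f i) k U) ∂(μW r sch k) :=
      fun k => integral_exp_pos (hint k ((hexp s).comp (hXv k)))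
    have hev : (fun k => ∫ x, Real.exp (∑ i, s i * x i) ∂(ν k)) =
        fun k => Real.exp (flowF r sch τ m f s k) := by
      funext k
      rw [hνint k _ (hexp s), flowF, Real.exp_log (hpos k)]
    rw [hev]
    exact (Real.continuous_exp.tendsto c).comp hc
  -- raw mixed moments converge (Curtiss)
  choose c hc using hC m ν hν δ hδ hhyp
  have hM : ∀ t : Finset (Fin m),
      Tendsto (fun k => ∫ U, ∏ i ∈ t, flowX r sch τ (f i) k U ∂(μW r sch k)) atTop
        (𝓝 (c fun i => if i ∈ t then 1 else 0)) := by
    intro t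
    have h1 : ∀ k, ∫ x, ∏ i, x i ^ (if i ∈ t then 1 else 0) ∂(ν k) =
        ∫ U, ∏ i ∈ t, flowX r sch τ (f i) k U ∂(μW r sch k) := by
      intro k
      rw [hνint k (fun x => ∏ i, x i ^ (if i ∈ t then 1 else 0))
        (continuous_finsetProd _ fun i _ => (continuous_apply i).pow _)]
      exact integral_congr_ae (Eventually.of_forall fun U => prod_pow_indicator t _)
    simpa only [h1] using hc fun i => if i ∈ t then 1 else 0
  have hb : ∀ i : Fin m,
      Tendsto (fun k => ∫ U, flowX r sch τ (f i) k U ∂(μW r sch k)) atTop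
        (𝓝 (c fun j => if j ∈ ({i} : Finset (Fin m)) then 1 else 0)) := by
    intro i
    simpa only [Finset.prod_singleton] using hM {i}
  -- expand the centred product and pass to the limit
  refine ⟨∑ t ∈ (Finset.univ : Finset (Fin m)).powerset, (c fun i => if i ∈ t then 1 else 0) *
    ∏ i ∈ Finset.univ \ t, -c fun j => if j ∈ ({i} : Finset (Fin m)) then 1 else 0, ?_⟩
  have hexpand : ∀ k, flowCMoment r sch τ m f k =
      ∑ t ∈ (Finset.univ : Finset (Fin m)).powerset,
        (∫ U, ∏ i ∈ t, flowX r sch τ (f i) k U ∂(μW r sch k)) *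
          ∏ i ∈ Finset.univ \ t, -∫ U, flowX r sch τ (f i) k U ∂(μW r sch k) := by
    intro k
    unfold flowCMoment
    simp_rw [sub_eq_add_neg, Finset.prod_add]
    have hI : ∀ t ∈ (Finset.univ : Finset (Fin m)).powerset,
        Integrable (fun U : GaugeConfig 4 (sch.side k) G => (∏ i ∈ t, flowX r sch τ (f i) k U) *
          ∏ i ∈ Finset.univ \ t, -∫ V, flowX r sch τ (f i) k V ∂(μW r sch k)) (μW r sch k) :=
      fun t _ => hint k ((continuous_finsetProd t fun i _ => hX k i).mul continuous_const)
    rw [integral_finsetSum _ hI]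
    exact Finset.sum_congr rfl fun t _ => integral_mul_const _ _
  refine Tendsto.congr (fun k => (hexpand k).symm) ?_
  exact tendsto_finsetSum _ fun t _ => (hM t).mul (tendsto_finsetProd _ fun i _ => (hb i).neg)

end Summit.QuantumFields.YangMills.Cruxes.ContinuumLimitOnTrajectory.CurtissFlowedFreeEnergies

end
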